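import Summits.BirchSwinnertonDyer.BirchSwinnertonDyer.Theorems.ThetaPartnerAtTwoSignedKatoUpToAtTwoKatoBKLevelIdentity
import Summits.BirchSwinnertonDyer.BirchSwinnertonDyer.Theorems.ThetaPartnerAtTwoSignedKatoUpToAtTwoCorePairPrimitiveCharValues
import Summits.BirchSwinnertonDyer.BirchSwinnertonDyer.Theorems.ThetaPartnerAtTwoSignedKatoUpToAtTwoKatoValueTransfer
import Summits.BirchSwinnertonDyer.BirchSwinnertonDyer.Theorems.ThetaPartnerAtTwoSignedKatoUpToAtTwoKatoConstantRational
import Summits.BirchSwinnertonDyer.BirchSwinnertonDyer.Theorems.ThetaPartnerAtTwoSignedKatoUpToAtTwoMultiplierAvoidance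
import Literature.NumberTheory.EllipticCurves.Kato2004.EulerSystemBoundFineSelmerTwo
import HarnessLib

/-!
# Route `ThetaPartnerAtTwo` (TP2), crux K3 `SignedKatoDivisibilityUpToAtTwo` (stmt-BirchSwinnertonDyer-20308 / K3P′ 25631), line
# `colemanrat` v12 → v13 — small helpers for the lead's socket (memo `G7-ASSEMBLY-v1`): even non-primitive characters mod 4, 8 are
# trivial; the displayed plus Honda point lies in `E₁`; parity / unit / gcd bookkeeping for Kato's guards `(c, 6·2·A) = (d, 6·2·N) = 1`

Lead prover `bsd-wall-tp2-p2x` g7 (cell `bsd-wall`). HONEST FRAMING: theorems only; closes no item; K3 / K3P′ NOT settled; BSD is NOT proved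
by any of this.
-/

set_option autoImplicit false
-- the Theorems namespace of this sub repeats the summit name by design (D-0017 nested layout)
set_option linter.dupNamespace false

noncomputable section

set_option backward.isDefEq.respectTransparency false

open scoped Classical MatrixGroups ModularForm NumberField TensorProduct

open CongruenceSubgroup WeierstrassCurve Field IsDedekindDomain NumberField
  Literature.NumberTheory.GaloisRepresentations
  Literature.NumberTheory.EllipticCurves Literature.NumberTheory.EllipticCurves.ModularForms
  Literature.NumberTheory.EllipticCurves.Module Literature.NumberTheory.EllipticCurves.Rank1Residual
  Literature.NumberTheory.EllipticCurves.Kobayashi2003 Literature.NumberTheory.EllipticCurves.Kato2004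
  Literature.NumberTheory.EllipticCurves.Kato2004.EulerSystemValues Literature.NumberTheory.EllipticCurves.GreenbergSelmer
  Literature.NumberTheory.EllipticCurves.Sprung2012
  Literature.NumberTheory.EllipticCurves.FormalGroupChart
  ZpExtension Summit.BirchSwinnertonDyer.Rank1Residual.Supersingular
  Summit.BirchSwinnertonDyer.Rank1Residual.Additive Summit.BirchSwinnertonDyer.Rank1Residual.Additive.PadicCyclotomicTower
  Summit.BirchSwinnertonDyer.Rank1Residual.Additive.BallEval
  Summit.BirchSwinnertonDyer.BirchSwinnertonDyer.Theorems.SignedKatoOffTwo.LocalTwo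

namespace Summit.BirchSwinnertonDyer.BirchSwinnertonDyer.Theorems.SignedKatoOffTwo.KatoBK

/-! ## §1 Small helpers -/

section Helpers

/-- An even Dirichlet character mod `2^{n+2}` with `n ≤ 1` which is not primitive is trivial (`(ℤ/4)ˣ = {±1}`; mod `8` an even
character with `χ(5) ≠ 1` is primitive, w5's `MultAvoid.isPrimitive_of_apply_five_pow_two_pow_ne_one`). [cite: Washington1997, §3] -/
theorem eq_one_of_even_of_not_isPrimitive {R : Type*} [Field R] {n : ℕ} (hn : n ≤ 1)
    (χ : DirichletCharacter R (2 ^ (n + 2))) (heven : χ (-1) = 1) (hprim : ¬ χ.IsPrimitive) : χ = 1 := by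
  -- `χ 5 = 1`
  have h5 : χ (5 : ZMod (2 ^ (n + 2))) = 1 := by
    interval_cases n
    · have h : (5 : ZMod (2 ^ (0 + 2))) = 1 := by decide
      rw [h, map_one]
    · by_contra h
      exact hprim (MultAvoid.isPrimitive_of_apply_five_pow_two_pow_ne_one 0 (ψ := χ) (by simpa using h))
  -- every unit of `ℤ/2^{n+2}` (`n ≤ 1`) is `±1` or `±5`
  refine MulChar.ext fun u ↦ ?_
  rw [MulChar.one_apply (Units.isUnit u)]
  have hneg5 : χ (-5 : ZMod (2 ^ (n + 2))) = 1 := by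
    rw [← neg_one_mul, map_mul, heven, h5, one_mul]
  have key : ∀ a : ZMod (2 ^ (n + 2)), IsUnit a → a = 1 ∨ a = -1 ∨ a = 5 ∨ a = -5 := by
    interval_cases n
    · decide
    · decide
  rcases key _ (Units.isUnit u) with h | h | h | h
  · rw [h, map_one]
  · rw [h, heven]
  · rw [h, h5]
  · rw [h, hneg5]

/-- `T⁻¹(d₀ n) ∈ E₁` for the displayed plus Honda point `d₀ n = 3•(c_{n+2} + σ•c_{n+2}) − 2•c_1` (the tower points lie in `E₁`,
which is Galois-stable). [cite: Kobayashi2003, §8.4] -/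
theorem toLoc_symm_plusPoint_mem_kernel (W : WeierstrassCurve ℚ) [W.IsGloballyMinimal]
    {c : ℕ → localPoints W ℚ_[2]} {σ : ℕ → Field.absoluteGaloisGroup ℚ_[2]} {d : ℕ → localPoints W ℚ_[2]}
    (hck : haveI := isIntegral_genFib_baseChange 2 ((integralModelInt W).map (Int.castRingHom ℤ_[2]))
      ∀ m, (toLoc ((genFibΩ_eq_baseChange ((integralModelInt W).map (Int.castRingHom ℤ_[2]))).trans
        (baseChange_twoAdicModel W))).symm (c m) ∈
          kernel (Valued.v (R := PadicAlgCl 2)) (genFibΩ 2 ((integralModelInt W).map (Int.castRingHom ℤ_[2]))))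
    (hd : ∀ n, d n = 3 • (c (n + 2) + σ (n + 2) • c (n + 2)) - 2 • c 1) (n : ℕ) :
    haveI := isIntegral_genFib_baseChange 2 ((integralModelInt W).map (Int.castRingHom ℤ_[2]))
    (toLoc ((genFibΩ_eq_baseChange ((integralModelInt W).map (Int.castRingHom ℤ_[2]))).trans
        (baseChange_twoAdicModel W))).symm (d n) ∈
      kernel (Valued.v (R := PadicAlgCl 2)) (genFibΩ 2 ((integralModelInt W).map (Int.castRingHom ℤ_[2]))) := by
  set M : WeierstrassCurve ℤ_[2] := (integralModelInt W).map (Int.castRingHom ℤ_[2]) with hM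
  haveI hintΩ := isIntegral_genFib_baseChange 2 M
  set hV := (genFibΩ_eq_baseChange M).trans (baseChange_twoAdicModel W) with hVdef
  set K := kernel (Valued.v (R := PadicAlgCl 2)) (genFibΩ 2 M) with hK
  have h1 : (toLoc hV).symm (c (n + 2)) ∈ K := @hck (n + 2)
  have h2 : (toLoc hV).symm (c 1) ∈ K := @hck 1
  have h3 : (toLoc hV).symm (σ (n + 2) • c (n + 2)) ∈ K :=
    @toLoc_symm_smul_mem_kernel W _ (σ (n + 2)) (c (n + 2)) (@hck (n + 2))
  have h4 : (toLoc hV).symm (c (n + 2)) + (toLoc hV).symm (σ (n + 2) • c (n + 2)) ∈ K := K.add_mem @h1 @h3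
  have h5 : 3 • ((toLoc hV).symm (c (n + 2)) + (toLoc hV).symm (σ (n + 2) • c (n + 2))) ∈ K := K.nsmul_mem @h4 3
  have h6 : 2 • (toLoc hV).symm (c 1) ∈ K := K.nsmul_mem @h2 2
  have h7 : 3 • ((toLoc hV).symm (c (n + 2)) + (toLoc hV).symm (σ (n + 2) • c (n + 2))) - 2 • (toLoc hV).symm (c 1) ∈ K :=
    K.sub_mem @h5 @h6
  rw [hd n, map_sub, map_nsmul, map_nsmul, map_add]
  exact @h7

/-- `Int.gcd t (6·2·X) = 1` forces `t` odd. [folklore] -/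
theorem not_two_dvd_of_gcd_eq_one {t X : ℤ} (h : Int.gcd t (6 * 2 * X) = 1) : ¬ (2 : ℤ) ∣ t := by
  intro h2
  have hd := Int.dvd_gcd h2 (show (2 : ℤ) ∣ 6 * 2 * X from ⟨6 * X, by ring⟩)
  rw [h] at hd
  norm_num at hd

/-- An odd integer is coprime to `2`. [folklore] -/
theorem isCoprime_two_of_not_two_dvd {t : ℤ} (ht : ¬ (2 : ℤ) ∣ t) : IsCoprime t 2 := by
  rw [Int.isCoprime_iff_gcd_eq_one]
  have hg : (Int.gcd t 2 : ℤ) ∣ 2 := Int.gcd_dvd_right t 2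
  rcases (Nat.dvd_prime Nat.prime_two).mp (by exact_mod_cast hg) with h | h
  · exact h
  · exfalso
    apply ht
    have h' : (Int.gcd t 2 : ℤ) ∣ t := Int.gcd_dvd_left t 2
    rw [h] at h'
    exact_mod_cast h'

/-- An odd integer is a unit modulo `2^m`. [folklore] -/
theorem isUnit_intCast_zmod_two_pow {t : ℤ} (ht : ¬ (2 : ℤ) ∣ t) (m : ℕ) : IsUnit ((t : ℤ) : ZMod (2 ^ m)) := by
  rw [ZMod.coe_int_isUnit_iff_isCoprime]
  push_cast
  exact (isCoprime_two_of_not_two_dvd ht).symm.pow_left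

/-- The gcd side condition of (B2): `gcd(c·d, 2^k·2^e) = 1` for odd `c, d`. [folklore] -/
theorem gcd_mul_cycLevel_mul_pow_eq_one {c d : ℤ} (hc : ¬ (2 : ℤ) ∣ c) (hd : ¬ (2 : ℤ) ∣ d) (k e : ℕ) :
    Int.gcd (c * d) (cycLevel 2 k (∅ : Finset (HeightOneSpectrum (𝓞 ℚ))) * 2 ^ e) = 1 := by
  rw [cycLevel_two_empty, ← Int.isCoprime_iff_gcd_eq_one]
  push_cast
  rw [← pow_add]
  exact ((isCoprime_two_of_not_two_dvd hc).mul_left (isCoprime_two_of_not_two_dvd hd)).pow_right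

/-- **(B2) at level `2^{n+2}` in the shape of the level identity** (w4's `KatoValue.charSumF_mul_gaussSum_eq` with the gcd side
condition discharged for odd `c, d` and `ψ(cd) = ψ(c)ψ(d)`). [cite: Kato2004Asterisque, Thm. 6.6 (1), Thm. 9.7] -/
theorem charSumF_mul_gaussSum_eq_two {W : WeierstrassCurve ℚ} [W.IsElliptic] {N : ℕ} [NeZero N] {f : CuspForm (Gamma0 N) 2}
    (hf : IsNewformOf W f)
    [ContinuousSMul ℤ_[2] (W.tateModule 2)] [Module.Free ℤ_[2] (W.tateModule 2)] [Module.Finite ℤ_[2] (W.tateModule 2)]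
    {ιC : (m : ℕ) → (CyclotomicField m ℚ →+* ℂ)} {κK : ℝ}
    {ΛK : ∀ (k : ℕ) (r : Finset (HeightOneSpectrum (𝓞 ℚ))),
      H1 (tateRep W 2) (cycSubgroup 2 k r) →ₗ[ℤ_[2]] ℚ_[2] ⊗[ℚ] CyclotomicField (cycLevel 2 k r) ℚ}
    {c dd a : ℤ} {ee : ℕ}
    {z : ∀ (k : ℕ) (r : (cyclotomicLevelsRat 2 (badPlaces c dd (2 ^ ee) N)).Ideals),
      H1 (tateRep W 2) ((cyclotomicLevelsRat 2 (badPlaces c dd (2 ^ ee) N)).level k r.1)}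
    {x : ∀ (k : ℕ) (r : (cyclotomicLevelsRat 2 (badPlaces c dd (2 ^ ee) N)).Ideals), CyclotomicField (cycLevel 2 k r.1) ℚ}
    (hbody : ZetaBody W 2 f ιC κK ΛK c dd a (2 ^ ee) z x) {q : ℚ} (hq : κK = q)
    (hcodd : ¬ (2 : ℤ) ∣ c) (hdodd : ¬ (2 : ℤ) ∣ dd) (d' : ℤ) (hdd' : dd * d' ≡ 1 [ZMOD ((2 ^ ee : ℕ) : ℤ)])
    {n : ℕ}
    (hιC : ιC (cycLevel 2 (n + 2) (∅ : Finset (HeightOneSpectrum (𝓞 ℚ))))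
        (IsCyclotomicExtension.zeta (cycLevel 2 (n + 2) (∅ : Finset (HeightOneSpectrum (𝓞 ℚ)))) ℚ
          (CyclotomicField (cycLevel 2 (n + 2) (∅ : Finset (HeightOneSpectrum (𝓞 ℚ)))) ℚ)) =
      Complex.exp (2 * Real.pi * Complex.I / (cycLevel 2 (n + 2) (∅ : Finset (HeightOneSpectrum (𝓞 ℚ))) : ℕ))) :
    ∀ ψF : DirichletCharacter (CyclotomicField (cycLevel 2 (n + 2) (∅ : Finset (HeightOneSpectrum (𝓞 ℚ)))) ℚ)
      (cycLevel 2 (n + 2) (∅ : Finset (HeightOneSpectrum (𝓞 ℚ)))), ψF (-1) = 1 → ψF.IsPrimitive →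
      (∑ b : (ZMod (cycLevel 2 (n + 2) (∅ : Finset (HeightOneSpectrum (𝓞 ℚ)))))ˣ,
          ψF⁻¹ (b : ZMod _) * sigma (cycLevel 2 (n + 2) (∅ : Finset (HeightOneSpectrum (𝓞 ℚ)))) b
            (x (n + 2) (cyclotomicLevelsRat 2 (badPlaces c dd (2 ^ ee) N)).idealOne)) *
          gaussSum ψF (AddChar.zmodChar (cycLevel 2 (n + 2) (∅ : Finset (HeightOneSpectrum (𝓞 ℚ))))
            (IsCyclotomicExtension.zeta_pow (cycLevel 2 (n + 2) (∅ : Finset (HeightOneSpectrum (𝓞 ℚ)))) ℚ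
              (CyclotomicField (cycLevel 2 (n + 2) (∅ : Finset (HeightOneSpectrum (𝓞 ℚ)))) ℚ))) =
        (q : CyclotomicField (cycLevel 2 (n + 2) ∅) ℚ) * ratTwistedSymbolSum f ψF *
          ((c : CyclotomicField (cycLevel 2 (n + 2) ∅) ℚ) ^ 2 * (dd : CyclotomicField (cycLevel 2 (n + 2) ∅) ℚ) ^ 2 *
              ((ratMinusSymbol f ((a : ℚ) / (2 ^ ee : ℕ)) : ℚ) : CyclotomicField (cycLevel 2 (n + 2) ∅) ℚ)
            - (c : CyclotomicField (cycLevel 2 (n + 2) ∅) ℚ) * (dd : CyclotomicField (cycLevel 2 (n + 2) ∅) ℚ) ^ 2 *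
              ψF (c : ZMod _) * ((ratMinusSymbol f ((a * c : ℚ) / (2 ^ ee : ℕ)) : ℚ) : CyclotomicField (cycLevel 2 (n + 2) ∅) ℚ)
            - (c : CyclotomicField (cycLevel 2 (n + 2) ∅) ℚ) ^ 2 * (dd : CyclotomicField (cycLevel 2 (n + 2) ∅) ℚ) *
              ψF (dd : ZMod _) * ((ratMinusSymbol f ((a * d' : ℚ) / (2 ^ ee : ℕ)) : ℚ) : CyclotomicField (cycLevel 2 (n + 2) ∅) ℚ)
            + (c : CyclotomicField (cycLevel 2 (n + 2) ∅) ℚ) * (dd : CyclotomicField (cycLevel 2 (n + 2) ∅) ℚ) *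
              (ψF (c : ZMod _) * ψF (dd : ZMod _)) *
              ((ratMinusSymbol f ((a * c * d' : ℚ) / (2 ^ ee : ℕ)) : ℚ) : CyclotomicField (cycLevel 2 (n + 2) ∅) ℚ)) := by
  intro ψF hev hψ
  have h := KatoValue.charSumF_mul_gaussSum_eq hf 2 hbody hq (by omega : 1 ≤ n + 2) rfl d'
    (gcd_mul_cycLevel_mul_pow_eq_one hcodd hdodd (n + 2) ee) hdd' hιC ψF hψ hev
  rw [Int.cast_mul, map_mul] at h
  exact h

/-- `2·|c|·|d|·2^e·N ≠ 0` under Kato's guards (`c, d ≠ 0`). [folklore] -/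
theorem level_ne_zero (N : ℕ) [NeZero N] (ee : ℕ) {c dd : ℤ} (hgc : Int.gcd c (6 * 2 * 2 ^ ee) = 1)
    (hgd : Int.gcd dd (6 * 2 * N) = 1) : 2 * c.natAbs * dd.natAbs * 2 ^ ee * N ≠ 0 := by
  have hc0 : c ≠ 0 := by
    rintro rfl
    rw [Int.gcd_zero_left] at hgc
    have h12 : (6 * 2 * (2 : ℤ) ^ ee).natAbs = 6 * 2 * 2 ^ ee := by
      rw [show (6 * 2 * (2 : ℤ) ^ ee) = ((6 * 2 * 2 ^ ee : ℕ) : ℤ) by push_cast; ring, Int.natAbs_natCast]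
    rw [h12] at hgc
    have : 1 ≤ 2 ^ ee := Nat.one_le_two_pow
    omega
  have hN0 : N ≠ 0 := NeZero.ne _
  have hd0 : dd ≠ 0 := by
    rintro rfl
    rw [Int.gcd_zero_left] at hgd
    have h12 : (6 * 2 * (N : ℤ)).natAbs = 6 * 2 * N := by
      rw [show (6 * 2 * (N : ℤ)) = ((6 * 2 * N : ℕ) : ℤ) by push_cast; ring, Int.natAbs_natCast]
    rw [h12] at hgd
    omega
  positivity

end Helpers

end Summit.BirchSwinnertonDyer.BirchSwinnertonDyer.Theorems.SignedKatoOffTwo.KatoBK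

end
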